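import Literature.NumberTheory.Automorphic.KNAQuotientIntegration             -- ★ Gelbart 9.22 (iii): `exists_lintegral_quotient_eq_mul_lintegral_lintegral`, `exists_measure_quotient_eq_smul_map`, `anMap`
import Literature.MeasureTheory.Group.InvariantQuotientConjugacySum            -- ★ `descConj`, `descConj_mk`
import Literature.NumberTheory.Automorphic.GLnLeviOrbitalDescent               -- ★ `measurable_quotient_iff` (and the GL_n template of this file)
import HarnessLib

/-!
# Torus descent of orbital integrals in Iwasawa coordinates, HYPOTHESIS-DRIVEN in the twist of the unipotent radical
# `∫_{G ⧸ T} F(y t y⁻¹) dμ = C · J(t) · ∫_{K × N} F(k (t n) k⁻¹) d(κ ⊗ μ_N)` (generic group layer)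

Topic `NumberTheory/Automorphic`; namespace `Literature.NumberTheory.Automorphic`.  KERNEL mathematics only: theorems, no definition, no
named fact, no instance, no notation, no `sorry`.  Cell `pub/hodgecm-mathlib`, programme P3a, road «D-N7-inert» brick (L8b) «torus descent of
orbital integrals at a NON-SPLIT place» — FILE A (generic group layer); FILE B = ★ `UnitaryGroupTorusOrbitalDescentNonsplit` (the CM local
carrier `U(Φ₃)(L⁺_v)`).  The GL_n (split-place) twin is ★ `GLnLeviOrbitalDescent`.  HC_CM is proved only modulo the 7 printed citations until rung 0
closes; this file discharges no named fact.

## The mathematics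

Let `G` be a locally compact second countable Hausdorff group with closed subgroups `K` (compact), `T`, `N`, `B` such that `B = T·N` topologically
(`T × N ≃ₜ B`, `T` normalising `N`) and `G = K·B`, all unimodular as needed (the Iwasawa datum of a reductive `p`-adic group with a Borel `B = TN`).
By Gelbart (1975), Thm. 9.22 (iii) (★ `KNAQuotientIntegration`) every non-zero `G`-invariant Radon measure `μ` on `G ⧸ T` is
`C • ((k, n) ↦ k n T)_* (κ ⊗ μ_N)` for one `C ≠ 0`, whence for the ORBITAL INTEGRAND `y T ↦ F(y t y⁻¹)` (★ `descConj`, `t` centralised by `T`)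
`∫_{G ⧸ T} F(y t y⁻¹) dμ = C ∫_K ∫_N F(k n t n⁻¹ k⁻¹) dμ_N dκ` (§1, `exists_lintegral_descConj_eq_mul_lintegral_lintegral`).  The remaining step of
Rogawski's Lemma 4.13.1 (a) ∕ (4.9.1), `Φ^G(t, f) = |D(t)|^{-1∕2} ∫_K ∫_N f(k t n k⁻¹)`, is the TWIST of `N` at `t`: the substitution
`n ↦ n t n⁻¹ t⁻¹` (a bijection of `N` for `t` regular, Jacobian `‖D_{G∕T}(t)‖⁻¹`; [Rogawski1990 §7.3 p. 97: «∫_N φ(u⁻¹ γ u) du = |Δ(γ)|⁻¹ ∫_N φ(γ u) du»];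
J. Arthur, Duke Math. J. 45 (1978), §8).  Here the twist enters as a PROPERTY BINDER on the existing objects — either in integral form
`hJac : ∀ Φ, ∫_N Φ(n t n⁻¹) dμ_N = J · ∫_N Φ(t n) dμ_N` (left) ∕ `= J · ∫_N Φ(n t) dμ_N` (right), or in measure form
`(n ↦ t⁻¹ n⁻¹ t n)_* μ_N = J • μ_N` ∕ `(n ↦ n⁻¹ t n t⁻¹)_* μ_N = J • μ_N` (lemmas `lintegral_conj_eq_mul_lintegral_…_of_map_eq_smul` turn the
measure form into the integral form) — and the file proves **`∫_{G ⧸ T} F(y t y⁻¹) dμ = C · J · ∫_{K × N} F(k (t n) k⁻¹) d(κ ⊗ μ_N)`** in the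
`∃ C`-form (`exists_lintegral_descConj_eq_mul_lintegral_[prod_]torus_mul_unipotent`, `…_unipotent_mul_torus`) and from the measure identity
`μ = C • …` (`lintegral_descConj_eq_mul_lintegral_prod[_torus_mul_unipotent ∕ _unipotent_mul_torus]_of_eq_smul_map`), the currency of ★
`ConstantTermUnitElement.lintegral_prod_indicator_conj_mul_unipotent` (the constant term of the unit).  Computing `J` (the local Heisenberg
chart) is NOT done here.

## References
* [Rogawski1990] J. D. Rogawski, *Automorphic Representations of Unitary Groups in Three Variables*, Ann. of Math. Stud. 123 (1990), §4.9
  (4.9.1)–(4.9.2) p. 55; §4.13 Lemma 4.13.1 (a) p. 64 and its proof p. 70; §7.3 p. 97.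
* [Gelbart1975] S. Gelbart, *Automorphic Forms on Adele Groups*, Ann. of Math. Stud. 83 (1975), Thm. 9.22 (iii), Remark 9.23.
* J. Arthur, *A trace formula for reductive groups I*, Duke Math. J. 45 (1978), §8 (the twist of `N` at a regular semisimple element).
* [Folland1995] G. B. Folland, *A Course in Abstract Harmonic Analysis* (1995), §2.6 Thm. 2.49.
-/

set_option autoImplicit false

noncomputable section

open MeasureTheory Measure Set Filter Topology
open scoped ENNReal NNReal

namespace Literature.NumberTheory.Automorphic

open Literature.MeasureTheory.Group

universe u

/-! ## §1 `G = K·B`, `B = T·N`, an invariant measure on `G ⧸ T`, and the twist of `N` as a PROPERTY binder -/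

section Generic

variable {G : Type u} [Group G] [TopologicalSpace G] [IsTopologicalGroup G] [LocallyCompactSpace G]
  [T2Space G] [SecondCountableTopology G] [MeasurableSpace G] [BorelSpace G]
  {K T N B : Subgroup G} (hK : IsCompact (K : Set G)) (hT : IsClosed (T : Set G)) (hB : IsClosed (B : Set G))
  (hTB : T ≤ B) (hNB : N ≤ B) (hTN : ∀ a ∈ T, ∀ n ∈ N, a * n * a⁻¹ ∈ N)
  (e : ↥T × ↥N ≃ₜ ↥B) (he : ∀ p, e p = anMap T N B hTB hNB p)
  (hKB : ∀ g : G, ∃ k ∈ K, ∃ b ∈ B, g = k * b)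
  (ν : Measure G) [IsHaarMeasure ν] [ν.IsInvInvariant]
  (κ : Measure ↥K) [IsHaarMeasure κ] [SFinite κ]
  (α : Measure ↥T) [IsHaarMeasure α] [α.IsInvInvariant] [SFinite α]
  (μN : Measure ↥N) [IsHaarMeasure μN] [μN.IsInvInvariant] [SFinite μN]
  [MeasurableSpace (G ⧸ T)] [BorelSpace (G ⧸ T)]
  (μ : Measure (G ⧸ T)) [SMulInvariantMeasure G (G ⧸ T) μ] [IsFiniteMeasureOnCompacts μ]

include hT in
/-- The orbital integrand `y T ↦ F(y t y⁻¹)` of a Borel `F` is Borel on `G ⧸ T` (`T` closed: the Borel σ-algebra of `G ⧸ T` is the quotient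
σ-algebra, ★ `measurable_quotient_iff`). [cite: Folland1995, §2.6 Thm. 2.49] -/
theorem measurable_descConj_of_measurable (t : G) (ht : ∀ a ∈ T, a * t = t * a) {F : G → ℝ≥0∞} (hF : Measurable F) :
    Measurable (descConj t T ht F) := by
  rw [measurable_quotient_iff hT]
  have h : (descConj t T ht F ∘ (QuotientGroup.mk : G → G ⧸ T)) = fun g => F (g * t * g⁻¹) := by
    funext g; exact descConj_mk t T ht F g
  rw [h]
  exact hF.comp ((continuous_id.mul continuous_const).mul continuous_id.inv).measurable

include hK hT hB hTN e he hKB ν α in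
/-- **`∫_{G ⧸ T} F(y t y⁻¹) dμ = C ∫_K ∫_N F((k n) t (k n)⁻¹) dμ_N dκ`** — the orbital integral over `G ⧸ T` in the Iwasawa coordinates `G = K·T·N`
(★ Gelbart 9.22 (iii) `exists_lintegral_quotient_eq_mul_lintegral_lintegral` at the orbital integrand; ONE `C ≠ 0` for all `(t, F)`).
[cite: Gelbart1975, Thm. 9.22 (iii) and Remark 9.23] [cite: Rogawski1990, §4.13, proof of Lemma 4.13.1, p. 70] -/
theorem exists_lintegral_descConj_eq_mul_lintegral_lintegral (hμ : μ ≠ 0) :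
    ∃ C : ℝ≥0, C ≠ 0 ∧ ∀ (t : G) (ht : ∀ a ∈ T, a * t = t * a) (F : G → ℝ≥0∞), Measurable F →
      ∫⁻ y, descConj t T ht F y ∂μ =
        C * ∫⁻ k, ∫⁻ n, F ((k : G) * (n : G) * t * ((k : G) * (n : G))⁻¹) ∂μN ∂κ := by
  obtain ⟨C, hC0, hKNA⟩ := exists_lintegral_quotient_eq_mul_lintegral_lintegral hK hT hB hTB hNB hTN e he hKB ν κ α μN μ hμ
  refine ⟨C, hC0, fun t ht F hF => ?_⟩
  rw [hKNA _ (measurable_descConj_of_measurable hT t ht hF)]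
  simp only [descConj_mk]

omit [LocallyCompactSpace G] [T2Space G] [SecondCountableTopology G] [IsHaarMeasure μN] [μN.IsInvInvariant] [SFinite μN] in
/-- **The twist step.** If the twist `n ↦ n t n⁻¹` of the unipotent radical at `t` has module `J` on the Haar measure `μ_N` in the INTEGRAL form
`∫_N Φ(n t n⁻¹) dμ_N = J · ∫_N Φ(t n) dμ_N` (the PROPERTY binder `hJac` — for the Heisenberg radical of `U(3)` at a regular `t` this is
«`∫_N φ(u⁻¹ γ u) du = |Δ(γ)|⁻¹ ∫_N φ(γ u) du`», [Rogawski1990 §7.3 p. 97]; J. Arthur, Duke Math. J. 45 (1978), §8), then for every `k`: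
`∫_N F((k n) t (k n)⁻¹) dμ_N = J · ∫_N F(k (t n) k⁻¹) dμ_N`. [cite: Rogawski1990, §7.3 p. 97; §4.13 p. 70] -/
theorem lintegral_conj_mul_eq_mul_of_twist (t : G) {J : ℝ≥0∞}
    (hJac : ∀ Φ : G → ℝ≥0∞, Measurable Φ → ∫⁻ n, Φ ((n : G) * t * (n : G)⁻¹) ∂μN = J * ∫⁻ n, Φ (t * (n : G)) ∂μN)
    {F : G → ℝ≥0∞} (hF : Measurable F) (k : G) :
    ∫⁻ n, F (k * (n : G) * t * (k * (n : G))⁻¹) ∂μN = J * ∫⁻ n, F (k * (t * (n : G)) * k⁻¹) ∂μN := by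
  have hΦ : Measurable fun g : G => F (k * g * k⁻¹) := hF.comp ((continuous_const.mul continuous_id).mul continuous_const).measurable
  have h1 : (fun n : ↥N => F (k * (n : G) * t * (k * (n : G))⁻¹)) = fun n : ↥N => (fun g : G => F (k * g * k⁻¹)) ((n : G) * t * (n : G)⁻¹) := by
    funext n; simp only [mul_inv_rev, mul_assoc]
  rw [h1, hJac _ hΦ]

include hK hT hB hTN e he hKB ν α in
/-- **TORUS DESCENT OF THE ORBITAL INTEGRAL, HYPOTHESIS-DRIVEN IN THE TWIST** (the non-split-place twin of ★
`GLnLeviOrbitalDescent.exists_lintegral_descConj_eq_mul_lintegral_levi`): ONE `C ≠ 0` such that for every `t` centralised by `T` whose twist on `N`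
has module `J` (binder `hJac`) and every Borel `F ≥ 0`,
**`∫_{G ⧸ T} F(y t y⁻¹) dμ = C · J · ∫_K ∫_N F(k (t n) k⁻¹) dμ_N dκ`** — Rogawski's `Φ^G(γ, f) = |D(γ)|^{−1∕2} Φ^T(γ, f̄^B)` at a torus element up to the
measure dictionary. [cite: Rogawski1990, §4.13 Lemma 4.13.1 (a) p. 64 and p. 70; §7.3 p. 97] [cite: Gelbart1975, Thm. 9.22 (iii)] -/
theorem exists_lintegral_descConj_eq_mul_lintegral_torus_mul_unipotent (hμ : μ ≠ 0) :
    ∃ C : ℝ≥0, C ≠ 0 ∧ ∀ (t : G) (ht : ∀ a ∈ T, a * t = t * a) {J : ℝ≥0∞}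
      (_hJac : ∀ Φ : G → ℝ≥0∞, Measurable Φ → ∫⁻ n, Φ ((n : G) * t * (n : G)⁻¹) ∂μN = J * ∫⁻ n, Φ (t * (n : G)) ∂μN)
      (F : G → ℝ≥0∞), Measurable F →
      ∫⁻ y, descConj t T ht F y ∂μ = C * J * ∫⁻ k, ∫⁻ n, F ((k : G) * (t * (n : G)) * (k : G)⁻¹) ∂μN ∂κ := by
  obtain ⟨C, hC0, hdesc⟩ := exists_lintegral_descConj_eq_mul_lintegral_lintegral hK hT hB hTB hNB hTN e he hKB ν κ α μN μ hμ
  refine ⟨C, hC0, fun t ht J hJac F hF => ?_⟩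
  rw [hdesc t ht F hF]
  have hk : ∀ k : ↥K, ∫⁻ n, F ((k : G) * (n : G) * t * ((k : G) * (n : G))⁻¹) ∂μN = J * ∫⁻ n, F ((k : G) * (t * (n : G)) * (k : G)⁻¹) ∂μN :=
    fun k => lintegral_conj_mul_eq_mul_of_twist μN t hJac hF (k : G)
  simp_rw [hk]
  have hmeas : Measurable fun k : ↥K => ∫⁻ n, F ((k : G) * (t * (n : G)) * (k : G)⁻¹) ∂μN := by
    haveI : SecondCountableTopology ↥K := TopologicalSpace.Subtype.secondCountableTopology _
    haveI : SecondCountableTopology ↥N := TopologicalSpace.Subtype.secondCountableTopology _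
    haveI : BorelSpace (↥K × ↥N) := Prod.borelSpace
    refine Measurable.lintegral_prod_right' (f := fun p : ↥K × ↥N => F ((p.1 : G) * (t * (p.2 : G)) * (p.1 : G)⁻¹)) ?_
    exact hF.comp ((((continuous_subtype_val.comp continuous_fst).mul
      (continuous_const.mul (continuous_subtype_val.comp continuous_snd))).mul
      (continuous_subtype_val.comp continuous_fst).inv).measurable)
  rw [lintegral_const_mul _ hmeas, mul_assoc]

omit [LocallyCompactSpace G] [T2Space G] [SecondCountableTopology G] [IsHaarMeasure μN] [SFinite μN] in
/-- **From the MEASURE form of the twist to its INTEGRAL form (left).** If `t` normalises `N` and the self-map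
`n ↦ (t⁻¹ n⁻¹ t) n` of `N` pushes the inversion-invariant Haar measure `μ_N` to `J • μ_N` (the PROPERTY binder `hJacμ` — for the Heisenberg
radical of `U(3)` at a regular torus element `J = ‖D_{G∕T}(t)‖⁻¹`, [Rogawski1990 §7.3 p. 97; Lemma 4.13.1 (a)]), then
`∫_N Φ(n t n⁻¹) dμ_N = J · ∫_N Φ(t n) dμ_N` for every Borel `Φ ≥ 0` (`n⁻¹ t n = t · (t⁻¹ n⁻¹ t n)`). [cite: Rogawski1990, §7.3 p. 97; §4.13 p. 70] -/
theorem lintegral_conj_eq_mul_lintegral_torus_mul_of_map_eq_smul (t : G) (htN : ∀ n ∈ N, t⁻¹ * n * t ∈ N) {J : ℝ≥0∞}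
    (hJacμ : Measure.map (fun n : ↥N => (⟨t⁻¹ * ((n : G)⁻¹) * t, htN _ (inv_mem n.2)⟩ : ↥N) * n) μN = J • μN)
    {Φ : G → ℝ≥0∞} (hΦ : Measurable Φ) :
    ∫⁻ n, Φ ((n : G) * t * (n : G)⁻¹) ∂μN = J * ∫⁻ n, Φ (t * (n : G)) ∂μN := by
  have hψ : Measurable fun n : ↥N => (⟨t⁻¹ * ((n : G)⁻¹) * t, htN _ (inv_mem n.2)⟩ : ↥N) * n :=
    ((((continuous_const.mul (continuous_subtype_val.inv)).mul continuous_const).subtype_mk _).mul continuous_id).measurable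
  have hΦt : Measurable fun m : ↥N => Φ (t * (m : G)) := hΦ.comp (continuous_const.mul continuous_subtype_val).measurable
  have h1 : ∫⁻ n, Φ ((n : G) * t * (n : G)⁻¹) ∂μN = ∫⁻ n, Φ (((n⁻¹ : ↥N) : G) * t * (((n⁻¹ : ↥N) : G))⁻¹) ∂μN :=
    (lintegral_inv_eq_self (μ := μN) (fun n : ↥N => Φ ((n : G) * t * (n : G)⁻¹))).symm
  have h2 : (fun n : ↥N => Φ (((n⁻¹ : ↥N) : G) * t * (((n⁻¹ : ↥N) : G))⁻¹)) =
      fun n : ↥N => (fun m : ↥N => Φ (t * (m : G))) ((⟨t⁻¹ * ((n : G)⁻¹) * t, htN _ (inv_mem n.2)⟩ : ↥N) * n) := by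
    funext n
    simp only [Subgroup.coe_inv, inv_inv, Subgroup.coe_mul, ← mul_assoc, mul_inv_cancel, one_mul]
  rw [h1, h2, ← lintegral_map hΦt hψ, hJacμ, lintegral_smul_measure]
  rfl

omit [LocallyCompactSpace G] [T2Space G] [SecondCountableTopology G] [IsHaarMeasure μN] [SFinite μN] in
/-- **From the MEASURE form of the twist to its INTEGRAL form (right)** — the shape `n ↦ n⁻¹ t n t⁻¹` of the lead's ruling: if that self-map of
`N` pushes `μ_N` to `J • μ_N` then `∫_N Φ(n t n⁻¹) dμ_N = J · ∫_N Φ(n t) dμ_N` (`n⁻¹ t n = (n⁻¹ t n t⁻¹) · t`).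
[cite: Rogawski1990, §7.3 p. 97; §4.13 p. 70] -/
theorem lintegral_conj_eq_mul_lintegral_mul_torus_of_map_eq_smul (t : G) (htN : ∀ n ∈ N, t * n * t⁻¹ ∈ N) {J : ℝ≥0∞}
    (hJacμ : Measure.map (fun n : ↥N => n⁻¹ * (⟨t * (n : G) * t⁻¹, htN _ n.2⟩ : ↥N)) μN = J • μN)
    {Φ : G → ℝ≥0∞} (hΦ : Measurable Φ) :
    ∫⁻ n, Φ ((n : G) * t * (n : G)⁻¹) ∂μN = J * ∫⁻ n, Φ ((n : G) * t) ∂μN := by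
  have hψ : Measurable fun n : ↥N => n⁻¹ * (⟨t * (n : G) * t⁻¹, htN _ n.2⟩ : ↥N) :=
    (continuous_id.inv.mul (((continuous_const.mul continuous_subtype_val).mul continuous_const).subtype_mk _)).measurable
  have hΦt : Measurable fun m : ↥N => Φ ((m : G) * t) := hΦ.comp (continuous_subtype_val.mul continuous_const).measurable
  have h1 : ∫⁻ n, Φ ((n : G) * t * (n : G)⁻¹) ∂μN = ∫⁻ n, Φ (((n⁻¹ : ↥N) : G) * t * (((n⁻¹ : ↥N) : G))⁻¹) ∂μN :=
    (lintegral_inv_eq_self (μ := μN) (fun n : ↥N => Φ ((n : G) * t * (n : G)⁻¹))).symm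
  have h2 : (fun n : ↥N => Φ (((n⁻¹ : ↥N) : G) * t * (((n⁻¹ : ↥N) : G))⁻¹)) =
      fun n : ↥N => (fun m : ↥N => Φ ((m : G) * t)) (n⁻¹ * (⟨t * (n : G) * t⁻¹, htN _ n.2⟩ : ↥N)) := by
    funext n
    simp only [Subgroup.coe_inv, inv_inv, Subgroup.coe_mul, mul_assoc, inv_mul_cancel, mul_one]
  rw [h1, h2, ← lintegral_map hΦt hψ, hJacμ, lintegral_smul_measure]
  rfl

omit [LocallyCompactSpace G] [T2Space G] [SecondCountableTopology G] [IsHaarMeasure μN] [μN.IsInvInvariant] [SFinite μN] in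
/-- The twist step, right form: `∫_N F((k n) t (k n)⁻¹) dμ_N = J · ∫_N F(k (n t) k⁻¹) dμ_N` under the right integral binder.
[cite: Rogawski1990, §7.3 p. 97; §4.13 p. 70] -/
theorem lintegral_conj_mul_eq_mul_of_twist_right (t : G) {J : ℝ≥0∞}
    (hJac : ∀ Φ : G → ℝ≥0∞, Measurable Φ → ∫⁻ n, Φ ((n : G) * t * (n : G)⁻¹) ∂μN = J * ∫⁻ n, Φ ((n : G) * t) ∂μN)
    {F : G → ℝ≥0∞} (hF : Measurable F) (k : G) :
    ∫⁻ n, F (k * (n : G) * t * (k * (n : G))⁻¹) ∂μN = J * ∫⁻ n, F (k * ((n : G) * t) * k⁻¹) ∂μN := by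
  have hΦ : Measurable fun g : G => F (k * g * k⁻¹) := hF.comp ((continuous_const.mul continuous_id).mul continuous_const).measurable
  have h1 : (fun n : ↥N => F (k * (n : G) * t * (k * (n : G))⁻¹)) = fun n : ↥N => (fun g : G => F (k * g * k⁻¹)) ((n : G) * t * (n : G)⁻¹) := by
    funext n; simp only [mul_inv_rev, mul_assoc]
  rw [h1, hJac _ hΦ]

include hK hT hB hTN e he hKB ν α in
/-- **TORUS DESCENT, right form**: `∫_{G ⧸ T} F(y t y⁻¹) dμ = C · J · ∫_K ∫_N F(k (n t) k⁻¹) dμ_N dκ` under the right integral binder (the one produced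
by the lead's measure-form binder, `lintegral_conj_eq_mul_lintegral_mul_torus_of_map_eq_smul`). [cite: Rogawski1990, §4.13 Lemma 4.13.1 (a) p. 64 and p. 70]
[cite: Gelbart1975, Thm. 9.22 (iii)] -/
theorem exists_lintegral_descConj_eq_mul_lintegral_unipotent_mul_torus (hμ : μ ≠ 0) :
    ∃ C : ℝ≥0, C ≠ 0 ∧ ∀ (t : G) (ht : ∀ a ∈ T, a * t = t * a) {J : ℝ≥0∞}
      (_hJac : ∀ Φ : G → ℝ≥0∞, Measurable Φ → ∫⁻ n, Φ ((n : G) * t * (n : G)⁻¹) ∂μN = J * ∫⁻ n, Φ ((n : G) * t) ∂μN)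
      (F : G → ℝ≥0∞), Measurable F →
      ∫⁻ y, descConj t T ht F y ∂μ = C * J * ∫⁻ k, ∫⁻ n, F ((k : G) * ((n : G) * t) * (k : G)⁻¹) ∂μN ∂κ := by
  obtain ⟨C, hC0, hdesc⟩ := exists_lintegral_descConj_eq_mul_lintegral_lintegral hK hT hB hTB hNB hTN e he hKB ν κ α μN μ hμ
  refine ⟨C, hC0, fun t ht J hJac F hF => ?_⟩
  rw [hdesc t ht F hF]
  have hk : ∀ k : ↥K, ∫⁻ n, F ((k : G) * (n : G) * t * ((k : G) * (n : G))⁻¹) ∂μN = J * ∫⁻ n, F ((k : G) * ((n : G) * t) * (k : G)⁻¹) ∂μN :=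
    fun k => lintegral_conj_mul_eq_mul_of_twist_right μN t hJac hF (k : G)
  simp_rw [hk]
  have hmeas : Measurable fun k : ↥K => ∫⁻ n, F ((k : G) * ((n : G) * t) * (k : G)⁻¹) ∂μN := by
    haveI : SecondCountableTopology ↥K := TopologicalSpace.Subtype.secondCountableTopology _
    haveI : SecondCountableTopology ↥N := TopologicalSpace.Subtype.secondCountableTopology _
    haveI : BorelSpace (↥K × ↥N) := Prod.borelSpace
    refine Measurable.lintegral_prod_right' (f := fun p : ↥K × ↥N => F ((p.1 : G) * ((p.2 : G) * t) * (p.1 : G)⁻¹)) ?_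
    exact hF.comp ((((continuous_subtype_val.comp continuous_fst).mul
      ((continuous_subtype_val.comp continuous_snd).mul continuous_const)).mul
      (continuous_subtype_val.comp continuous_fst).inv).measurable)
  rw [lintegral_const_mul _ hmeas, mul_assoc]

include hK hT hB hTN e he hKB ν α in
/-- **TORUS DESCENT in PRODUCT form** (the currency of ★ `ConstantTermUnitElement.lintegral_prod_indicator_conj_mul_unipotent`):
`∫_{G ⧸ T} F(y t y⁻¹) dμ = C · J · ∫_{K × N} F(k (t n) k⁻¹) d(κ ⊗ μ_N)`. [cite: Rogawski1990, §4.13 Lemma 4.13.1 (a) p. 64 and p. 70] [cite: Gelbart1975, Thm. 9.22 (iii)] -/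
theorem exists_lintegral_descConj_eq_mul_lintegral_prod_torus_mul_unipotent (hμ : μ ≠ 0) :
    ∃ C : ℝ≥0, C ≠ 0 ∧ ∀ (t : G) (ht : ∀ a ∈ T, a * t = t * a) {J : ℝ≥0∞}
      (_hJac : ∀ Φ : G → ℝ≥0∞, Measurable Φ → ∫⁻ n, Φ ((n : G) * t * (n : G)⁻¹) ∂μN = J * ∫⁻ n, Φ (t * (n : G)) ∂μN)
      (F : G → ℝ≥0∞), Measurable F →
      ∫⁻ y, descConj t T ht F y ∂μ = C * J * ∫⁻ p : ↥K × ↥N, F ((p.1 : G) * (t * (p.2 : G)) * (p.1 : G)⁻¹) ∂(κ.prod μN) := by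
  obtain ⟨C, hC0, hdesc⟩ := exists_lintegral_descConj_eq_mul_lintegral_torus_mul_unipotent hK hT hB hTB hNB hTN e he hKB ν κ α μN μ hμ
  refine ⟨C, hC0, fun t ht J hJac F hF => ?_⟩
  rw [hdesc t ht hJac F hF]
  haveI : SecondCountableTopology ↥K := TopologicalSpace.Subtype.secondCountableTopology _
  haveI : SecondCountableTopology ↥N := TopologicalSpace.Subtype.secondCountableTopology _
  haveI : BorelSpace (↥K × ↥N) := Prod.borelSpace
  have hm : Measurable fun p : ↥K × ↥N => F ((p.1 : G) * (t * (p.2 : G)) * (p.1 : G)⁻¹) :=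
    hF.comp ((((continuous_subtype_val.comp continuous_fst).mul
      (continuous_const.mul (continuous_subtype_val.comp continuous_snd))).mul
      (continuous_subtype_val.comp continuous_fst).inv).measurable)
  rw [lintegral_prod _ hm.aemeasurable]

/-! ### The same identities from the MEASURE IDENTITY `μ = C • ((k, n) ↦ k n T)_* (κ ⊗ μ_N)` (one `C` for all consumers) -/

omit [IsHaarMeasure κ] [SFinite κ] [IsHaarMeasure μN] [μN.IsInvInvariant] [SFinite μN] [SMulInvariantMeasure G (G ⧸ T) μ]
  [IsFiniteMeasureOnCompacts μ] in
include hT in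
/-- **`∫_{G ⧸ T} F(y t y⁻¹) dμ = C ∫_{K × N} F((k n) t (k n)⁻¹) d(κ ⊗ μ_N)`** once `μ = C • ((k, n) ↦ k n T)_* (κ ⊗ μ_N)` (the `lintegral` twin of ★
`GLnLeviQuotientIwasawaIntegration.integral_descConj_eq_smul_integral_prod`; `T` closed makes the orbital integrand Borel).
[cite: Gelbart1975, Thm. 9.22 (iii) and Remark 9.23] -/
theorem lintegral_descConj_eq_mul_lintegral_prod_of_eq_smul_map {C : ℝ≥0}
    (hμC : μ = C • Measure.map (fun p : ↥K × ↥N => (QuotientGroup.mk ((p.1 : G) * (p.2 : G)) : G ⧸ T)) (κ.prod μN))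
    (t : G) (ht : ∀ a ∈ T, a * t = t * a) {F : G → ℝ≥0∞} (hF : Measurable F) :
    ∫⁻ y, descConj t T ht F y ∂μ = C * ∫⁻ p : ↥K × ↥N, F ((p.1 : G) * (p.2 : G) * t * ((p.1 : G) * (p.2 : G))⁻¹) ∂(κ.prod μN) := by
  haveI : SecondCountableTopology ↥K := TopologicalSpace.Subtype.secondCountableTopology _
  haveI : SecondCountableTopology ↥N := TopologicalSpace.Subtype.secondCountableTopology _
  haveI : BorelSpace (↥K × ↥N) := Prod.borelSpace
  have hmk : Measurable fun p : ↥K × ↥N => (QuotientGroup.mk ((p.1 : G) * (p.2 : G)) : G ⧸ T) :=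
    (continuous_quotient_mk'.comp ((continuous_subtype_val.comp continuous_fst).mul
      (continuous_subtype_val.comp continuous_snd))).measurable
  rw [hμC, lintegral_smul_measure, lintegral_map (measurable_descConj_of_measurable hT t ht hF) hmk]
  simp only [descConj_mk, ENNReal.smul_def, smul_eq_mul]

omit [IsHaarMeasure κ] [SFinite κ] [IsHaarMeasure μN] [μN.IsInvInvariant] [SMulInvariantMeasure G (G ⧸ T) μ] [IsFiniteMeasureOnCompacts μ] in
include hT in
/-- **TORUS DESCENT from the measure identity, left twist**: `μ = C • ((k, n) ↦ k n T)_* (κ ⊗ μ_N)` and the left integral twist binder at `t` give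
`∫_{G ⧸ T} F(y t y⁻¹) dμ = C · J · ∫_{K × N} F(k (t n) k⁻¹) d(κ ⊗ μ_N)`. [cite: Rogawski1990, §4.13 Lemma 4.13.1 (a) p. 64 and p. 70] [cite: Gelbart1975, Thm. 9.22 (iii)] -/
theorem lintegral_descConj_eq_mul_lintegral_prod_torus_mul_unipotent_of_eq_smul_map {C : ℝ≥0}
    (hμC : μ = C • Measure.map (fun p : ↥K × ↥N => (QuotientGroup.mk ((p.1 : G) * (p.2 : G)) : G ⧸ T)) (κ.prod μN))
    (t : G) (ht : ∀ a ∈ T, a * t = t * a) {J : ℝ≥0∞}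
    (hJac : ∀ Φ : G → ℝ≥0∞, Measurable Φ → ∫⁻ n, Φ ((n : G) * t * (n : G)⁻¹) ∂μN = J * ∫⁻ n, Φ (t * (n : G)) ∂μN)
    {F : G → ℝ≥0∞} (hF : Measurable F) :
    ∫⁻ y, descConj t T ht F y ∂μ = C * J * ∫⁻ p : ↥K × ↥N, F ((p.1 : G) * (t * (p.2 : G)) * (p.1 : G)⁻¹) ∂(κ.prod μN) := by
  rw [lintegral_descConj_eq_mul_lintegral_prod_of_eq_smul_map hT κ μN μ hμC t ht hF]
  haveI : SecondCountableTopology ↥K := TopologicalSpace.Subtype.secondCountableTopology _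
  haveI : SecondCountableTopology ↥N := TopologicalSpace.Subtype.secondCountableTopology _
  haveI : BorelSpace (↥K × ↥N) := Prod.borelSpace
  have hm1 : Measurable fun p : ↥K × ↥N => F ((p.1 : G) * (p.2 : G) * t * ((p.1 : G) * (p.2 : G))⁻¹) :=
    hF.comp (((((continuous_subtype_val.comp continuous_fst).mul (continuous_subtype_val.comp continuous_snd)).mul
      continuous_const).mul ((continuous_subtype_val.comp continuous_fst).mul
      (continuous_subtype_val.comp continuous_snd)).inv).measurable)
  have hm2 : Measurable fun p : ↥K × ↥N => F ((p.1 : G) * (t * (p.2 : G)) * (p.1 : G)⁻¹) :=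
    hF.comp ((((continuous_subtype_val.comp continuous_fst).mul
      (continuous_const.mul (continuous_subtype_val.comp continuous_snd))).mul
      (continuous_subtype_val.comp continuous_fst).inv).measurable)
  rw [lintegral_prod _ hm1.aemeasurable, lintegral_prod _ hm2.aemeasurable]
  have hk : ∀ k : ↥K, ∫⁻ n, F ((k : G) * (n : G) * t * ((k : G) * (n : G))⁻¹) ∂μN = J * ∫⁻ n, F ((k : G) * (t * (n : G)) * (k : G)⁻¹) ∂μN :=
    fun k => lintegral_conj_mul_eq_mul_of_twist μN t hJac hF (k : G)
  simp_rw [hk]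
  rw [lintegral_const_mul _ hm2.lintegral_prod_right', mul_assoc]

omit [IsHaarMeasure κ] [SFinite κ] [IsHaarMeasure μN] [μN.IsInvInvariant] [SMulInvariantMeasure G (G ⧸ T) μ] [IsFiniteMeasureOnCompacts μ] in
include hT in
/-- **TORUS DESCENT from the measure identity, right twist** (the twist shape `n ↦ n⁻¹ t n t⁻¹`):
`∫_{G ⧸ T} F(y t y⁻¹) dμ = C · J · ∫_{K × N} F(k (n t) k⁻¹) d(κ ⊗ μ_N)`. [cite: Rogawski1990, §4.13 Lemma 4.13.1 (a) p. 64 and p. 70] [cite: Gelbart1975, Thm. 9.22 (iii)] -/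
theorem lintegral_descConj_eq_mul_lintegral_prod_unipotent_mul_torus_of_eq_smul_map {C : ℝ≥0}
    (hμC : μ = C • Measure.map (fun p : ↥K × ↥N => (QuotientGroup.mk ((p.1 : G) * (p.2 : G)) : G ⧸ T)) (κ.prod μN))
    (t : G) (ht : ∀ a ∈ T, a * t = t * a) {J : ℝ≥0∞}
    (hJac : ∀ Φ : G → ℝ≥0∞, Measurable Φ → ∫⁻ n, Φ ((n : G) * t * (n : G)⁻¹) ∂μN = J * ∫⁻ n, Φ ((n : G) * t) ∂μN)
    {F : G → ℝ≥0∞} (hF : Measurable F) :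
    ∫⁻ y, descConj t T ht F y ∂μ = C * J * ∫⁻ p : ↥K × ↥N, F ((p.1 : G) * ((p.2 : G) * t) * (p.1 : G)⁻¹) ∂(κ.prod μN) := by
  rw [lintegral_descConj_eq_mul_lintegral_prod_of_eq_smul_map hT κ μN μ hμC t ht hF]
  haveI : SecondCountableTopology ↥K := TopologicalSpace.Subtype.secondCountableTopology _
  haveI : SecondCountableTopology ↥N := TopologicalSpace.Subtype.secondCountableTopology _
  haveI : BorelSpace (↥K × ↥N) := Prod.borelSpace
  have hm1 : Measurable fun p : ↥K × ↥N => F ((p.1 : G) * (p.2 : G) * t * ((p.1 : G) * (p.2 : G))⁻¹) :=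
    hF.comp (((((continuous_subtype_val.comp continuous_fst).mul (continuous_subtype_val.comp continuous_snd)).mul
      continuous_const).mul ((continuous_subtype_val.comp continuous_fst).mul
      (continuous_subtype_val.comp continuous_snd)).inv).measurable)
  have hm2 : Measurable fun p : ↥K × ↥N => F ((p.1 : G) * ((p.2 : G) * t) * (p.1 : G)⁻¹) :=
    hF.comp ((((continuous_subtype_val.comp continuous_fst).mul
      ((continuous_subtype_val.comp continuous_snd).mul continuous_const)).mul
      (continuous_subtype_val.comp continuous_fst).inv).measurable)
  rw [lintegral_prod _ hm1.aemeasurable, lintegral_prod _ hm2.aemeasurable]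
  have hk : ∀ k : ↥K, ∫⁻ n, F ((k : G) * (n : G) * t * ((k : G) * (n : G))⁻¹) ∂μN = J * ∫⁻ n, F ((k : G) * ((n : G) * t) * (k : G)⁻¹) ∂μN :=
    fun k => lintegral_conj_mul_eq_mul_of_twist_right μN t hJac hF (k : G)
  simp_rw [hk]
  rw [lintegral_const_mul _ hm2.lintegral_prod_right', mul_assoc]

end Generic

end Literature.NumberTheory.Automorphic

end
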